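import Mathlib
import HarnessLib
import Summits.HubbardSuperconductivity.HubbardSuperconductivity.Theorems.KLProgrammeKLRegimeVolumeLimitTwoPointTimeEntryDictionary

/-!
# Child `KLRegimeVolumeLimitV12` (stmt-HubbardSuperconductivity-19858), `stub_vl_bound` via (H1): the POINTWISE MATCH on a marked piece —
# the τ-resolved Grassmann two-point limit determinant at a generic two-block configuration is MINUS the determinant of the explicit
# before-rule matrix of the split-pair word `c_{y}(0)·∏(n−½)(n−½)(−βu_i)·c†_{x}(−(β−s))·∏(n−½)(n−½)(−β((β−s)/β+u′_l))`
# (seat hubbard-kl-k3c4-p2, g3; «Matsubara all-U route (R-a)»; design C3 of HOME/hubbard-kl-k3c5-p1/H1-DESIGN.md)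

The before-rule matrix `Ẽ` (index `0` = split pair, row = creation `X = c†_{x̄ₑσ}` at operator time `θ_X = ((β−s)/β)·(−β)`, column =
annihilation `Y = c_{ȳₑσ′}` at operator time `0`; index `succ m` = vertex pair `m` at operator time `w_{a(m)}·(−β)`, merged Dyson variables
`w = u ⧺ ((β−s)/β + u′)`), written with the closed Fermi-matrix forms of `gibbsState_dGamma_prod_evolved_eq_det`:
* `(0,0)`: `Y` precedes `X` ⇒ `−⟨a⁻_Y(0) a⁺_X(θ_X)⟩ = −[e^{−0h}(1+e^{−βh})⁻¹e^{θ_X h}]_{(ȳₑσ′),(x̄ₑσ)}`;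
* `(succ m, 0)`: `Y` first ⇒ `−[e^{−0h}(1+e^{−βh})⁻¹e^{θ_m h}]_{(ȳₑσ′),(x_mς_m)}`;
* `(0, succ m′)`: `X` precedes annihilation `m′` iff pair `m′` lies in the SECOND block (`k ≤ a(m′)`):
  `[e^{−θ_{m′}h}(1+e^{βh})⁻¹e^{θ_X h}]` resp. `−[e^{−θ_{m′}h}(1+e^{−βh})⁻¹e^{θ_X h}]`, entry `((x_{m′}ς′_{m′}),(x̄ₑσ))`;
* `(succ m, succ m′)`: t2's shifted vertex block `twoPointWordMatrix … x w (succ m) (succ m′)` (`propMatrix` rule minus `½` on the diagonal).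

**`twoPointTimeDet_eq_neg_det_beforeRule`**: for `L ≥ 3`, `0 < s < β`, `u` strictly increasing in `(0,(β−s)/β)`, `u′` strictly increasing in
`(0, s/β)` and any vertex sites `x : Fin (k+j) → 𝕋_L`, the Grassmann limit determinant at external times `(s,0)` and vertex times
`β(1 − w_a)` equals `−det Ẽ`.  Entrywise: column `0` of `Ẽ` is `−1` times the Grassmann column (the KMS sign of `Y`:
`vertexLimitEntry_eq_fermiMatrix_entry_of_neg_kms`), every other entry IS the Grassmann entry (`…_of_neg'`/`…_of_pos'`, t2's
`twoPointLimit_entry_succ_succ`).  With C2 (`⟨word⟩ = −det(Msplit − D)`, k3c5-p1) and `Msplit − D = Ẽ` (an `ext` on their side) this is the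
`hmatch` of `hasSum_twoPointTime_of_ae_match`.  Everything is proved; no definition.
-/

noncomputable section

namespace Summit.HubbardSuperconductivity.HubbardSuperconductivity.Theorems.MatsubaraAllU

set_option linter.dupNamespace false -- summit = problem name (single-conjunct summit), D-0017

open Finset NormedSpace Literature.MathematicalPhysics.QuantumLattice Literature.Probability.LatticeModels

variable {L : ℕ} [NeZero L]

/-- Merging two strictly increasing blocks separated by `a`: `u < a` pointwise and `0 < u′` pointwise give a strictly increasing
`u ⧺ (a + u′)`. -/
theorem strictMono_append_add {k j : ℕ} {u : Fin k → ℝ} {u' : Fin j → ℝ} (hu : StrictMono u) (hu' : StrictMono u') {a : ℝ}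
    (hua : ∀ i, u i < a) (hu'0 : ∀ l, 0 < u' l) :
    StrictMono (Fin.append u (fun l => a + u' l) : Fin (k + j) → ℝ) := by
  intro p q hpq
  have hpq' : (p : ℕ) < (q : ℕ) := Fin.lt_def.1 hpq
  induction p using Fin.addCases with
  | left p₁ =>
    induction q using Fin.addCases with
    | left q₁ =>
      simp only [Fin.append_left]
      simp only [Fin.val_castAdd] at hpq'
      exact hu (Fin.lt_def.2 hpq')
    | right q₂ =>
      simp only [Fin.append_left, Fin.append_right]
      linarith [hua p₁, hu'0 q₂]
  | right p₂ =>
    induction q using Fin.addCases with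
    | left q₁ =>
      exfalso
      simp only [Fin.val_natAdd, Fin.val_castAdd] at hpq'
      have := q₁.isLt
      omega
    | right q₂ =>
      simp only [Fin.append_right]
      simp only [Fin.val_natAdd] at hpq'
      have : p₂ < q₂ := Fin.lt_def.2 (by omega)
      linarith [hu' this]

/-- **THE POINTWISE MATCH (C3) on a marked piece.**  See the module docstring for the before-rule matrix `Ẽ`. -/
theorem twoPointTimeDet_eq_neg_det_beforeRule (hL : 3 ≤ L) {β : ℝ} (hβ : 0 < β) (μ : ℝ) (σ σ' : Fin 2) (xe ye : TorusSite 2 L)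
    {s : ℝ} (hs0 : 0 < s) (hsβ : s < β) {k j : ℕ} (x : Fin (k + j) → TorusSite 2 L)
    {u : Fin k → ℝ} {u' : Fin j → ℝ} (hu : StrictMono u) (hu' : StrictMono u')
    (huI : ∀ i, u i ∈ Set.Ioo (0 : ℝ) ((β - s) / β)) (hu'I : ∀ l, u' l ∈ Set.Ioo (0 : ℝ) (s / β)) :
    (Matrix.of fun i j' : Fin ((k + j) * 2 + 1) =>
        vertexLimitEntry L β μ ((Fin.append x ![xe, ye] : Fin (k + j + 2) → TorusSite 2 L) (twoPointPlusEnum (k + j) σ i).1)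
          ((Fin.append x ![xe, ye] : Fin (k + j + 2) → TorusSite 2 L) (twoPointMinusEnum (k + j) σ' j').1)
          (twoPointPlusEnum (k + j) σ i).2 (twoPointMinusEnum (k + j) σ' j').2
          ((Fin.append (fun a : Fin (k + j) => β * (1 - Fin.append u (fun l => (β - s) / β + u' l) a)) ![s, 0] :
              Fin (k + j + 2) → ℝ) (twoPointMinusEnum (k + j) σ' j').1 -
            (Fin.append (fun a : Fin (k + j) => β * (1 - Fin.append u (fun l => (β - s) / β + u' l) a)) ![s, 0] :
              Fin (k + j + 2) → ℝ) (twoPointPlusEnum (k + j) σ i).1)).det =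
      -(Matrix.of (Fin.cases
          (Fin.cases
            (-(exp (-((0 : ℂ) • hubbardOneBody (fermionTorusGraph 2 L) 1 μ)) *
                (1 + exp (-((β : ℂ) • hubbardOneBody (fermionTorusGraph 2 L) 1 μ)))⁻¹ *
                exp (((((β - s) / β : ℝ) : ℂ) * -(β : ℂ)) • hubbardOneBody (fermionTorusGraph 2 L) 1 μ))
              (orb (FermionTorus.ofTorusSite ye) σ') (orb (FermionTorus.ofTorusSite xe) σ))
            (fun m' : Fin ((k + j) * 2) =>
              if k ≤ ((finProdFinEquiv.symm m' : Fin (k + j) × Fin 2).1 : ℕ) then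
                (exp (-((((Fin.append u (fun l => (β - s) / β + u' l) (finProdFinEquiv.symm m' : Fin (k + j) × Fin 2).1 : ℝ) : ℂ) *
                      -(β : ℂ)) • hubbardOneBody (fermionTorusGraph 2 L) 1 μ)) *
                    (1 + exp ((β : ℂ) • hubbardOneBody (fermionTorusGraph 2 L) 1 μ))⁻¹ *
                    exp (((((β - s) / β : ℝ) : ℂ) * -(β : ℂ)) • hubbardOneBody (fermionTorusGraph 2 L) 1 μ))
                  (orb (FermionTorus.ofTorusSite (x (finProdFinEquiv.symm m' : Fin (k + j) × Fin 2).1))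
                    (finProdFinEquiv.symm m' : Fin (k + j) × Fin 2).2) (orb (FermionTorus.ofTorusSite xe) σ)
              else
                -(exp (-((((Fin.append u (fun l => (β - s) / β + u' l) (finProdFinEquiv.symm m' : Fin (k + j) × Fin 2).1 : ℝ) : ℂ) *
                      -(β : ℂ)) • hubbardOneBody (fermionTorusGraph 2 L) 1 μ)) *
                    (1 + exp (-((β : ℂ) • hubbardOneBody (fermionTorusGraph 2 L) 1 μ)))⁻¹ *
                    exp (((((β - s) / β : ℝ) : ℂ) * -(β : ℂ)) • hubbardOneBody (fermionTorusGraph 2 L) 1 μ))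
                  (orb (FermionTorus.ofTorusSite (x (finProdFinEquiv.symm m' : Fin (k + j) × Fin 2).1))
                    (finProdFinEquiv.symm m' : Fin (k + j) × Fin 2).2) (orb (FermionTorus.ofTorusSite xe) σ)))
          (fun m : Fin ((k + j) * 2) => Fin.cases
            (-(exp (-((0 : ℂ) • hubbardOneBody (fermionTorusGraph 2 L) 1 μ)) *
                (1 + exp (-((β : ℂ) • hubbardOneBody (fermionTorusGraph 2 L) 1 μ)))⁻¹ *
                exp ((((Fin.append u (fun l => (β - s) / β + u' l) (finProdFinEquiv.symm m : Fin (k + j) × Fin 2).1 : ℝ) : ℂ) *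
                  -(β : ℂ)) • hubbardOneBody (fermionTorusGraph 2 L) 1 μ))
              (orb (FermionTorus.ofTorusSite ye) σ')
              (orb (FermionTorus.ofTorusSite (x (finProdFinEquiv.symm m : Fin (k + j) × Fin 2).1))
                (finProdFinEquiv.symm m : Fin (k + j) × Fin 2).2))
            (fun m' : Fin ((k + j) * 2) =>
              twoPointWordMatrix L β μ σ σ' xe ye x (Fin.append u (fun l => (β - s) / β + u' l)) m.succ m'.succ)) :
          Fin ((k + j) * 2 + 1) → Fin ((k + j) * 2 + 1) → ℂ)).det := by
  classical
  have hβ0 : β ≠ 0 := hβ.ne'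
  set a₁ : ℝ := (β - s) / β with ha₁
  have hβa₁ : β * a₁ = β - s := by rw [ha₁]; field_simp
  have ha₁1 : a₁ < 1 := by rw [ha₁, div_lt_one hβ]; linarith
  have ha₁s : a₁ + s / β = 1 := by rw [ha₁]; field_simp; ring
  have ha₁pos : 0 < a₁ := by rw [ha₁]; exact div_pos (by linarith) hβ
  set w : Fin (k + j) → ℝ := Fin.append u (fun l => (β - s) / β + u' l) with hw
  have hw_left : ∀ i, w (Fin.castAdd j i) = u i := fun i => by simp [hw]
  have hw_right : ∀ l, w (Fin.natAdd k l) = a₁ + u' l := fun l => by simp [hw, ha₁]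
  have hwmono : StrictMono w := strictMono_append_add hu hu' (fun i => (huI i).2) (fun l => (hu'I l).1)
  -- block membership by index ↔ position relative to `a₁`, and the range `(0,1)`
  have hblock : ∀ a : Fin (k + j), (k ≤ (a : ℕ) → a₁ < w a) ∧ (¬ k ≤ (a : ℕ) → w a < a₁) ∧ 0 < w a ∧ w a < 1 := by
    intro a
    induction a using Fin.addCases with
    | left i =>
      have hi : ¬ k ≤ ((Fin.castAdd j i : Fin (k + j)) : ℕ) := by simp [Fin.val_castAdd]
      refine ⟨fun h => (hi h).elim, fun _ => by rw [hw_left]; exact (huI i).2, by rw [hw_left]; exact (huI i).1,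
        by rw [hw_left]; exact (huI i).2.trans ha₁1⟩
    | right l =>
      have hl : k ≤ ((Fin.natAdd k l : Fin (k + j)) : ℕ) := by simp [Fin.val_natAdd]
      refine ⟨fun _ => by rw [hw_right]; linarith [(hu'I l).1], fun h => (h hl).elim,
        by rw [hw_right]; linarith [(hu'I l).1], by rw [hw_right]; linarith [(hu'I l).2]⟩
  -- the complex operator times
  have hθX : (((β - s) / β : ℝ) : ℂ) * -(β : ℂ) = (s : ℂ) - (β : ℂ) := by
    rw [← ha₁]
    have : ((a₁ : ℝ) : ℂ) * (β : ℂ) = ((β * a₁ : ℝ) : ℂ) := by push_cast; ring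
    rw [mul_neg, this, hβa₁]; push_cast; ring
  -- time lookups of the extended configuration
  have ht0 : (Fin.append (fun a : Fin (k + j) => β * (1 - w a)) ![s, 0] : Fin (k + j + 2) → ℝ) (Fin.natAdd (k + j) 0) = s := by
    simp [Fin.append_right]
  have ht1 : (Fin.append (fun a : Fin (k + j) => β * (1 - w a)) ![s, 0] : Fin (k + j + 2) → ℝ) (Fin.natAdd (k + j) 1) = 0 := by
    simp [Fin.append_right]
  have hta : ∀ a, (Fin.append (fun a : Fin (k + j) => β * (1 - w a)) ![s, 0] : Fin (k + j + 2) → ℝ) (Fin.castAdd 2 a) =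
      β * (1 - w a) := fun a => by simp [Fin.append_left]
  have hx0 : (Fin.append x ![xe, ye] : Fin (k + j + 2) → TorusSite 2 L) (Fin.natAdd (k + j) 0) = xe := by simp [Fin.append_right]
  have hx1 : (Fin.append x ![xe, ye] : Fin (k + j + 2) → TorusSite 2 L) (Fin.natAdd (k + j) 1) = ye := by simp [Fin.append_right]
  have hxa : ∀ a, (Fin.append x ![xe, ye] : Fin (k + j + 2) → TorusSite 2 L) (Fin.castAdd 2 a) = x a := fun a => by
    simp [Fin.append_left]
  -- the Grassmann matrix `E` and the signs `c = (−1, 1, …, 1)` on the columns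
  set E : Matrix (Fin ((k + j) * 2 + 1)) (Fin ((k + j) * 2 + 1)) ℂ := Matrix.of fun i j' : Fin ((k + j) * 2 + 1) =>
    vertexLimitEntry L β μ ((Fin.append x ![xe, ye] : Fin (k + j + 2) → TorusSite 2 L) (twoPointPlusEnum (k + j) σ i).1)
      ((Fin.append x ![xe, ye] : Fin (k + j + 2) → TorusSite 2 L) (twoPointMinusEnum (k + j) σ' j').1)
      (twoPointPlusEnum (k + j) σ i).2 (twoPointMinusEnum (k + j) σ' j').2
      ((Fin.append (fun a : Fin (k + j) => β * (1 - w a)) ![s, 0] : Fin (k + j + 2) → ℝ) (twoPointMinusEnum (k + j) σ' j').1 -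
        (Fin.append (fun a : Fin (k + j) => β * (1 - w a)) ![s, 0] : Fin (k + j + 2) → ℝ) (twoPointPlusEnum (k + j) σ i).1)
    with hE
  set c : Fin ((k + j) * 2 + 1) → ℂ := Fin.cons (-1 : ℂ) (fun _ : Fin ((k + j) * 2) => (1 : ℂ)) with hc
  -- ENTRYWISE: the before-rule matrix is `c j · E i j`
  have hentry : ∀ i j' : Fin ((k + j) * 2 + 1),
      (Matrix.of (Fin.cases
          (Fin.cases
            (-(exp (-((0 : ℂ) • hubbardOneBody (fermionTorusGraph 2 L) 1 μ)) *
                (1 + exp (-((β : ℂ) • hubbardOneBody (fermionTorusGraph 2 L) 1 μ)))⁻¹ *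
                exp (((((β - s) / β : ℝ) : ℂ) * -(β : ℂ)) • hubbardOneBody (fermionTorusGraph 2 L) 1 μ))
              (orb (FermionTorus.ofTorusSite ye) σ') (orb (FermionTorus.ofTorusSite xe) σ))
            (fun m' : Fin ((k + j) * 2) =>
              if k ≤ ((finProdFinEquiv.symm m' : Fin (k + j) × Fin 2).1 : ℕ) then
                (exp (-((((w (finProdFinEquiv.symm m' : Fin (k + j) × Fin 2).1 : ℝ) : ℂ) *
                      -(β : ℂ)) • hubbardOneBody (fermionTorusGraph 2 L) 1 μ)) *
                    (1 + exp ((β : ℂ) • hubbardOneBody (fermionTorusGraph 2 L) 1 μ))⁻¹ *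
                    exp (((((β - s) / β : ℝ) : ℂ) * -(β : ℂ)) • hubbardOneBody (fermionTorusGraph 2 L) 1 μ))
                  (orb (FermionTorus.ofTorusSite (x (finProdFinEquiv.symm m' : Fin (k + j) × Fin 2).1))
                    (finProdFinEquiv.symm m' : Fin (k + j) × Fin 2).2) (orb (FermionTorus.ofTorusSite xe) σ)
              else
                -(exp (-((((w (finProdFinEquiv.symm m' : Fin (k + j) × Fin 2).1 : ℝ) : ℂ) *
                      -(β : ℂ)) • hubbardOneBody (fermionTorusGraph 2 L) 1 μ)) *
                    (1 + exp (-((β : ℂ) • hubbardOneBody (fermionTorusGraph 2 L) 1 μ)))⁻¹ *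
                    exp (((((β - s) / β : ℝ) : ℂ) * -(β : ℂ)) • hubbardOneBody (fermionTorusGraph 2 L) 1 μ))
                  (orb (FermionTorus.ofTorusSite (x (finProdFinEquiv.symm m' : Fin (k + j) × Fin 2).1))
                    (finProdFinEquiv.symm m' : Fin (k + j) × Fin 2).2) (orb (FermionTorus.ofTorusSite xe) σ)))
          (fun m : Fin ((k + j) * 2) => Fin.cases
            (-(exp (-((0 : ℂ) • hubbardOneBody (fermionTorusGraph 2 L) 1 μ)) *
                (1 + exp (-((β : ℂ) • hubbardOneBody (fermionTorusGraph 2 L) 1 μ)))⁻¹ *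
                exp ((((w (finProdFinEquiv.symm m : Fin (k + j) × Fin 2).1 : ℝ) : ℂ) *
                  -(β : ℂ)) • hubbardOneBody (fermionTorusGraph 2 L) 1 μ))
              (orb (FermionTorus.ofTorusSite ye) σ')
              (orb (FermionTorus.ofTorusSite (x (finProdFinEquiv.symm m : Fin (k + j) × Fin 2).1))
                (finProdFinEquiv.symm m : Fin (k + j) × Fin 2).2))
            (fun m' : Fin ((k + j) * 2) =>
              twoPointWordMatrix L β μ σ σ' xe ye x w m.succ m'.succ)) :
          Fin ((k + j) * 2 + 1) → Fin ((k + j) * 2 + 1) → ℂ)) i j' = c j' * E i j' := by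
    intro i j'
    refine Fin.cases ?_ (fun m => ?_) i <;> refine Fin.cases ?_ (fun m' => ?_) j'
    · -- (0,0): `Y` first ⇒ `−⟨a⁻_Y(0) a⁺_X(s−β)⟩ = −vLE(0 − s)` (KMS form)
      simp only [Matrix.of_apply, Fin.cases_zero, hE, hc, Fin.cons_zero, twoPointPlusEnum_zero, twoPointMinusEnum_zero, hx0, hx1,
        ht0, ht1, neg_one_mul, neg_inj]
      exact (vertexLimitEntry_eq_fermiMatrix_entry_of_neg_kms hL β μ σ σ' xe ye (d := 0 - s) (by linarith) _ 0
        (by rw [hθX]; push_cast; ring)).symm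
    · -- (0, succ m'): `X` versus the annihilation of pair `m'`
      simp only [Matrix.of_apply, Fin.cases_zero, Fin.cases_succ, hE, hc, Fin.cons_succ, twoPointPlusEnum_zero, twoPointMinusEnum_succ,
        hx0, hxa, ht0, hta, one_mul]
      obtain ⟨hb₁, hb₂, -, -⟩ := hblock (finProdFinEquiv.symm m' : Fin (k + j) × Fin 2).1
      split_ifs with hkm
      · -- second block: `X` precedes, time difference `< 0`
        have hlt := hb₁ hkm
        have hd : β * (1 - w (finProdFinEquiv.symm m' : Fin (k + j) × Fin 2).1) - s < 0 := by nlinarith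
        exact (vertexLimitEntry_eq_fermiMatrix_entry_of_neg' hL β μ σ _ xe _ hd _ _ (by rw [hθX]; push_cast; ring)).symm
      · -- first block: annihilation precedes, time difference `> 0`
        have hlt := hb₂ hkm
        have hd : 0 < β * (1 - w (finProdFinEquiv.symm m' : Fin (k + j) × Fin 2).1) - s := by nlinarith
        exact (vertexLimitEntry_eq_neg_fermiMatrix_entry_of_pos' hL β μ σ _ xe _ hd _ _ (by rw [hθX]; push_cast; ring)).symm
    · -- (succ m, 0): `Y` first ⇒ KMS form
      simp only [Matrix.of_apply, Fin.cases_zero, Fin.cases_succ, hE, hc, Fin.cons_zero, twoPointPlusEnum_succ, twoPointMinusEnum_zero,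
        hx1, hxa, ht1, hta, neg_one_mul, neg_inj]
      obtain ⟨-, -, -, hw1⟩ := hblock (finProdFinEquiv.symm m : Fin (k + j) × Fin 2).1
      have hd : 0 - β * (1 - w (finProdFinEquiv.symm m : Fin (k + j) × Fin 2).1) < 0 := by nlinarith
      exact (vertexLimitEntry_eq_fermiMatrix_entry_of_neg_kms hL β μ _ σ' _ ye hd _ 0 (by push_cast; ring)).symm
    · -- (succ m, succ m'): t2's vertex block
      simp only [Matrix.of_apply, Fin.cases_succ, hE, hc, Fin.cons_succ, twoPointPlusEnum_succ, twoPointMinusEnum_succ, hxa, hta, one_mul]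
      exact (twoPointLimit_entry_succ_succ hL hβ μ σ σ' xe ye x hwmono m m').symm
  -- DETERMINANTS: `det Ẽ = (∏ c) det E = − det E`
  have hmat : (Matrix.of (Fin.cases
          (Fin.cases
            (-(exp (-((0 : ℂ) • hubbardOneBody (fermionTorusGraph 2 L) 1 μ)) *
                (1 + exp (-((β : ℂ) • hubbardOneBody (fermionTorusGraph 2 L) 1 μ)))⁻¹ *
                exp (((((β - s) / β : ℝ) : ℂ) * -(β : ℂ)) • hubbardOneBody (fermionTorusGraph 2 L) 1 μ))
              (orb (FermionTorus.ofTorusSite ye) σ') (orb (FermionTorus.ofTorusSite xe) σ))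
            (fun m' : Fin ((k + j) * 2) =>
              if k ≤ ((finProdFinEquiv.symm m' : Fin (k + j) × Fin 2).1 : ℕ) then
                (exp (-((((w (finProdFinEquiv.symm m' : Fin (k + j) × Fin 2).1 : ℝ) : ℂ) *
                      -(β : ℂ)) • hubbardOneBody (fermionTorusGraph 2 L) 1 μ)) *
                    (1 + exp ((β : ℂ) • hubbardOneBody (fermionTorusGraph 2 L) 1 μ))⁻¹ *
                    exp (((((β - s) / β : ℝ) : ℂ) * -(β : ℂ)) • hubbardOneBody (fermionTorusGraph 2 L) 1 μ))
                  (orb (FermionTorus.ofTorusSite (x (finProdFinEquiv.symm m' : Fin (k + j) × Fin 2).1))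
                    (finProdFinEquiv.symm m' : Fin (k + j) × Fin 2).2) (orb (FermionTorus.ofTorusSite xe) σ)
              else
                -(exp (-((((w (finProdFinEquiv.symm m' : Fin (k + j) × Fin 2).1 : ℝ) : ℂ) *
                      -(β : ℂ)) • hubbardOneBody (fermionTorusGraph 2 L) 1 μ)) *
                    (1 + exp (-((β : ℂ) • hubbardOneBody (fermionTorusGraph 2 L) 1 μ)))⁻¹ *
                    exp (((((β - s) / β : ℝ) : ℂ) * -(β : ℂ)) • hubbardOneBody (fermionTorusGraph 2 L) 1 μ))
                  (orb (FermionTorus.ofTorusSite (x (finProdFinEquiv.symm m' : Fin (k + j) × Fin 2).1))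
                    (finProdFinEquiv.symm m' : Fin (k + j) × Fin 2).2) (orb (FermionTorus.ofTorusSite xe) σ)))
          (fun m : Fin ((k + j) * 2) => Fin.cases
            (-(exp (-((0 : ℂ) • hubbardOneBody (fermionTorusGraph 2 L) 1 μ)) *
                (1 + exp (-((β : ℂ) • hubbardOneBody (fermionTorusGraph 2 L) 1 μ)))⁻¹ *
                exp ((((w (finProdFinEquiv.symm m : Fin (k + j) × Fin 2).1 : ℝ) : ℂ) *
                  -(β : ℂ)) • hubbardOneBody (fermionTorusGraph 2 L) 1 μ))
              (orb (FermionTorus.ofTorusSite ye) σ')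
              (orb (FermionTorus.ofTorusSite (x (finProdFinEquiv.symm m : Fin (k + j) × Fin 2).1))
                (finProdFinEquiv.symm m : Fin (k + j) × Fin 2).2))
            (fun m' : Fin ((k + j) * 2) =>
              twoPointWordMatrix L β μ σ σ' xe ye x w m.succ m'.succ)) :
          Fin ((k + j) * 2 + 1) → Fin ((k + j) * 2 + 1) → ℂ)) =
      Matrix.of fun i j' : Fin ((k + j) * 2 + 1) => c j' * E i j' := by
    ext i j'
    rw [hentry i j', Matrix.of_apply]
  have hprod : ∏ i, c i = -1 := by rw [Fin.prod_univ_succ]; simp [hc]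
  rw [hmat, Matrix.det_mul_row, hprod]
  ring

end Summit.HubbardSuperconductivity.HubbardSuperconductivity.Theorems.MatsubaraAllU

end
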